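import Mathlib
import Summits.KontsevichZagierPeriods.Zeta5Search.LaiPhiTilde
import Literature.NumberTheory.DiophantineApproximation.PrimeFractionalPartClassesCutoff
import HarnessLib

/-!
# Finite cell tables for the saving factor `Φ_n` of Lai's construction: the rate EXISTS and is explicit

Sub-problem `KontsevichZagierPeriods/Zeta5Search`, family `fam-indep` (linear independence /
dimension), generation 5. Systematic search; no irrationality claim unless certified.

The conditional assembly `kappa3_three_le_oddZetaSpanRank_of_savingRate` (`LaiKappa3Assembly.lean`)
leaves exactly one structural hypothesis: the EXISTENCE of the saving rate
`lim (1/n) log Φ_n = ϖ` for an admissible exponent table `e` of the saving factor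
`Φ_n = laiPhiGen J M dmin e n = ∏_{J ≤ p ≤ (M − 2 dmin) n, p² > Mn} p^{e(n,p)}` (`LaiSaving.lean`), and its
enclosure `38700 ≤ ϖ ≤ 80000`. This file removes the existence question for the tables one can actually
certify: a FINITE CELL TABLE `T` — finitely many cells `[u, v) ⊂ [1/(M − 2 dmin), 1]` with exponents
`c ∈ ℕ` — defines the table `cellExp T n p = Σ_{cells ∋ {n/p}} c` (membership of the fractional part
`{n/p} = (n mod p)/p`, computed in `ℚ`), and for it

* `tendsto_log_laiPhiGen_cellExp_div` — **`(1/n) log Φ_n ⟶ cellRate T = Σ_cells c · Σ_k (1/(k+u) − 1/(k+v))`**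
  (`= Σ c (ψ(v) − ψ(u))`), by the prime number theorem on the classes `{n/p} ∈ [u, v)` with the cut-off
  `p² > Mn` — the tree's PROVED `RhinViola.tendsto_sum_log_prime_fract_div_cutoff`
  (`Literature/…/PrimeFractionalPartClassesCutoff.lean`), summed over the cells (the condition `J ≤ p` is
  eventually implied by `p² > Mn`, and the prime range `p ≤ (M − 2 dmin) n` is exactly the range
  `p ≤ n/u` of the lemma once `u ≥ 1/(M − 2 dmin)`);
* `densityTrunc_le_density`, `density_le_densityUB` — computable rational lower / upper bounds
  `Σ_{k<K} (1/(k+u) − 1/(k+v)) ≤ Σ_k (…) ≤ (v − u)(1/u² + 2)` of a cell's density, so that both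
  inequalities `38700 ≤ ϖ`, `ϖ ≤ 80000` become decidable statements about `T`;
* `laiExpAdmissible_cellExp` — for pairwise disjoint cells, admissibility of `cellExp T`
  (`LaiExpAdmissible`, the hypothesis of `laiCoef_isInt_phi` / `laiCoef_dvd3_phi`) reduces to the per-cell
  statement `c ≤ laiPhiDiv J r M n δ k p` whenever `{n/p}` lies in the cell (a two-variable floor
  inequality on a rational box, of the kind certified cell by cell for Zudilin's `φ₀` in
  `Literature/…/ZudilinPhi.lean`, `ZudilinPhiTable*.lean`).

So 'κ₃ ≤ 73' is reduced (in `LaiKappa3Cells.lean`) to exhibiting ONE admissible finite cell table with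
truncated value `≥ 38700` — a finite certificate; the limit for the full table (exponent = the minimum of
`φ̃(n/p, ·)`, a step function of `{n/p}` with ≈ 3·10⁵ pieces at the family's point `(74, 2180, 444; δ74)`,
value `ϖ̃ = 38764.19…` computed by the `zeta5-calc` lane, uncertified; the shape of
[Lai2024BallRivoal, Lemma 5.3]) is not needed. HONEST FRAMING: a reduction and an existence theorem for cell
tables; no table reaching `38700` is certified here; 'κ₃ ≤ 73' stays a manuscript-level candidate.

## References

* [Lai2024BallRivoal] L. Lai, *Small improvements on the Ball–Rivoal theorem and its p-adic variant*,
  arXiv:2407.14236, §4 (4.5)–(4.6) (the factor `Φ_n = ∏ q^{φ(n/q)}`), Lemma 4.3 (the `Φ`-upgrade of the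
  denominators), Lemma 5.3 (5.19) (`Φ_n = exp(ϖ n + o(n))`, `ϖ = ∫₀¹ φ dψ − ∫₀^{1/(M−2δ₁)} φ dx/x²`, by
  the prime number theorem on the classes of `{n/q}`).
* [Zudilin2004] W. Zudilin, *Arithmetic of linear forms involving odd zeta values*, J. Théor. Nombres
  Bordeaux 16 (2004), §8 p. 270–271 (the same computation for `Φ_n`, with a finite table of cells).
-/

noncomputable section

open Finset Filter Topology

namespace Summit.KontsevichZagierPeriods.Zeta5Search

/-! ### Cells and cell tables -/

/-- A cell of a finite saving table: the class `u ≤ {n/p} < v` of primes receives the exponent `c`.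
[cite: Zudilin2004, §8 p. 271] -/
structure SavingCell where
  /-- left endpoint of the class of `{n/p}` -/
  u : ℚ
  /-- right endpoint (excluded) -/
  v : ℚ
  /-- the exponent of the primes of the class -/
  c : ℕ

namespace SavingCell

/-- `{n/p} ∈ [u, v)`, computed exactly as `(n mod p)/p` in `ℚ` (a `Bool`, for kernel evaluation).
[folklore] -/
def mem (C : SavingCell) (n p : ℕ) : Bool :=
  decide (C.u ≤ ((n % p : ℕ) : ℚ) / p) && decide (((n % p : ℕ) : ℚ) / p < C.v)

/-- What `mem` decides. [folklore] -/
theorem mem_iff (C : SavingCell) (n p : ℕ) :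
    C.mem n p = true ↔ C.u ≤ ((n % p : ℕ) : ℚ) / p ∧ ((n % p : ℕ) : ℚ) / p < C.v := by
  simp [mem]

/-- Well-formedness of a cell for the prime range `p ≤ λ n`: `1/λ ≤ u < v ≤ 1` (a `Bool`). [folklore] -/
def WF (lam : ℕ) (C : SavingCell) : Bool :=
  decide ((1 : ℚ) / lam ≤ C.u) && decide (C.u < C.v) && decide (C.v ≤ 1)

/-- What `WF` decides. [folklore] -/
theorem wf_iff (lam : ℕ) (C : SavingCell) :
    C.WF lam = true ↔ (1 : ℚ) / lam ≤ C.u ∧ C.u < C.v ∧ C.v ≤ 1 := by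
  simp [WF, and_assoc]

/-- The density `Σ_k (1/(k+u) − 1/(k+v)) = ψ(v) − ψ(u)` of the primes of the class (prime number theorem).
[cite: Zudilin2004, §8 p. 270] -/
def density (C : SavingCell) : ℝ :=
  ∑' k : ℕ, (1 / ((k : ℝ) + (C.u : ℝ)) - 1 / ((k : ℝ) + (C.v : ℝ)))

/-- Truncated density `Σ_{k<K} (1/(k+u) − 1/(k+v))`, a computable rational lower bound. [folklore] -/
def densityTrunc (C : SavingCell) (K : ℕ) : ℚ :=
  ∑ k ∈ range K, (1 / ((k : ℚ) + C.u) - 1 / ((k : ℚ) + C.v))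

/-- The computable rational upper bound `(v − u)(1/u² + 2)` of the density. [folklore] -/
def densityUB (C : SavingCell) : ℚ := (C.v - C.u) * (1 / C.u ^ 2 + 2)

end SavingCell

/-- The exponent table of a list of cells: `e(n, p) = Σ_{cells ∋ {n/p}} c`. [cite: Zudilin2004, §8 (8.8)] -/
def cellExp (T : List SavingCell) (n p : ℕ) : ℕ :=
  (T.map fun C => if C.mem n p then C.c else 0).sum

/-- The rate of a cell table: `Σ_cells c · (ψ(v) − ψ(u))`. [cite: Zudilin2004, §8 p. 270] -/
def cellRate (T : List SavingCell) : ℝ :=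
  (T.map fun C => (C.c : ℝ) * C.density).sum

/-- Truncated rate `Σ_cells c · Σ_{k<K} (…)` (computable, rational). [folklore] -/
def cellRateTrunc (T : List SavingCell) (K : ℕ) : ℚ :=
  (T.map fun C => (C.c : ℚ) * C.densityTrunc K).sum

/-- Upper rate `Σ_cells c · (v − u)(1/u² + 2)` (computable, rational). [folklore] -/
def cellRateUB (T : List SavingCell) : ℚ :=
  (T.map fun C => (C.c : ℚ) * C.densityUB).sum

/-! ### `log Φ_n` as a prime sum -/

/-- The primes of the saving factor: `J ≤ p ≤ (M − 2 dmin) n`, `p² > Mn`. [cite: Lai2024BallRivoal, §4 (4.5)] -/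
def laiPrimes (J M dmin n : ℕ) : Finset ℕ :=
  (range ((M - 2 * dmin) * n + 1)).filter (fun p => p.Prime ∧ J ≤ p ∧ M * n < p ^ 2)

/-- `log Φ_n = Σ_p e(n,p) log p`. [folklore] -/
theorem log_laiPhiGen (J M dmin : ℕ) (e : ℕ → ℕ → ℕ) (n : ℕ) :
    Real.log ((laiPhiGen J M dmin e n : ℕ) : ℝ) = ∑ p ∈ laiPrimes J M dmin n, (e n p : ℝ) * Real.log p := by
  unfold laiPhiGen
  rw [show (range ((M - 2 * dmin) * n + 1)).filter (fun p => p.Prime ∧ J ≤ p ∧ M * n < p ^ 2)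
      = laiPrimes J M dmin n from rfl]
  push_cast
  rw [Real.log_prod]
  · exact sum_congr rfl fun p _ => Real.log_pow _ _
  · intro p hp
    have hpr : p.Prime := (Finset.mem_filter.1 hp).2.1
    exact pow_ne_zero _ (by exact_mod_cast hpr.ne_zero)

/-- The prime sum of one cell: `Σ_p [p ∈ cell] c log p = c Σ_{p ∈ cell} log p`. [folklore] -/
theorem sum_cell_eq (J M dmin n : ℕ) (C : SavingCell) :
    ∑ p ∈ laiPrimes J M dmin n, (((if C.mem n p then C.c else 0 : ℕ) : ℝ)) * Real.log p
      = (C.c : ℝ) * ∑ p ∈ (laiPrimes J M dmin n).filter (fun p => C.mem n p), Real.log p := by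
  rw [sum_filter, mul_sum]
  refine sum_congr rfl fun p _ => ?_
  split_ifs <;> simp

/-! ### One cell: the prime number theorem on the class, with the cut-off -/

/-- For `n ≥ J²` (and `M ≥ 1`) the class of a well-formed cell inside `laiPrimes` is exactly the set of the
tree lemma `RhinViola.tendsto_sum_log_prime_fract_div_cutoff` with `N n = (M − 2 dmin) n`, `C = M`.
[folklore] -/
theorem cell_filter_eq (J M dmin : ℕ) (hM : 1 ≤ M) (C : SavingCell) {n : ℕ} (hn : J ^ 2 ≤ n) :
    (laiPrimes J M dmin n).filter (fun p => C.mem n p)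
      = (range ((M - 2 * dmin) * n + 1)).filter (fun p : ℕ => p.Prime ∧ (M : ℝ) * n < ((p : ℝ)) ^ 2 ∧
          (C.u : ℝ) ≤ Int.fract ((n : ℝ) / p) ∧ Int.fract ((n : ℝ) / p) < (C.v : ℝ)) := by
  ext p
  simp only [laiPrimes, Finset.mem_filter, Finset.mem_range, SavingCell.mem, Bool.and_eq_true,
    decide_eq_true_eq]
  have ecast : ∀ q : ℚ, ((q : ℝ)) = q := fun q => rfl
  have efr : Int.fract ((n : ℝ) / p) = ((((n % p : ℕ) : ℚ) / p : ℚ) : ℝ) := by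
    rw [Int.fract_div_natCast_eq_div_natCast_mod]; push_cast; rfl
  have esq : (M : ℝ) * n < ((p : ℝ)) ^ 2 ↔ M * n < p ^ 2 := by exact_mod_cast Iff.rfl
  rw [efr, Rat.cast_le, Rat.cast_lt, esq]
  constructor
  · rintro ⟨⟨hr, hpr, -, hsq⟩, hu, hv⟩
    exact ⟨hr, ⟨hpr, hsq, hu, hv⟩⟩
  · rintro ⟨hr, hpr, hsq, hu, hv⟩
    refine ⟨⟨hr, hpr, ?_, hsq⟩, hu, hv⟩
    have h1 : J ^ 2 < p ^ 2 := by
      calc J ^ 2 ≤ n := hn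
        _ ≤ M * n := Nat.le_mul_of_pos_left n hM
        _ < p ^ 2 := hsq
    exact le_of_lt (lt_of_pow_lt_pow_left₀ 2 (Nat.zero_le _) h1)

/-- **One cell.** `(1/n) Σ_{p ∈ laiPrimes, {n/p} ∈ [u,v)} log p ⟶ Σ_k (1/(k+u) − 1/(k+v))` for a
well-formed cell. [cite: Zudilin2004, §8 p. 270] -/
theorem tendsto_sum_log_cell_div (J M dmin : ℕ) (h2 : 2 * dmin < M) (C : SavingCell)
    (hC : C.WF (M - 2 * dmin) = true) :
    Tendsto (fun n : ℕ => (∑ p ∈ (laiPrimes J M dmin n).filter (fun p => C.mem n p), Real.log p) / n)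
      atTop (𝓝 C.density) := by
  obtain ⟨hu0, huv, hv1⟩ := (SavingCell.wf_iff _ _).1 hC
  have hlam : 0 < M - 2 * dmin := Nat.sub_pos_of_lt h2
  have hM : 1 ≤ M := by omega
  have hlamR : (0 : ℝ) < ((M - 2 * dmin : ℕ) : ℝ) := by exact_mod_cast hlam
  have hu0R : (1 : ℝ) / ((M - 2 * dmin : ℕ) : ℝ) ≤ (C.u : ℝ) := by
    have h := (Rat.cast_le (K := ℝ)).2 hu0
    rw [Rat.cast_div, Rat.cast_one, Rat.cast_natCast] at h
    exact h
  have hu : (0 : ℝ) < (C.u : ℝ) := lt_of_lt_of_le (by positivity) hu0R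
  have huvR : (C.u : ℝ) < (C.v : ℝ) := by exact_mod_cast huv
  have hv1R : (C.v : ℝ) ≤ 1 := by exact_mod_cast hv1
  have hN : ∀ n : ℕ, (n : ℝ) / (C.u : ℝ) ≤ (((M - 2 * dmin) * n : ℕ) : ℝ) := by
    intro n
    rw [div_le_iff₀ hu]
    push_cast
    have h1 : (1 : ℝ) ≤ ((M - 2 * dmin : ℕ) : ℝ) * (C.u : ℝ) := by
      have := mul_le_mul_of_nonneg_left hu0R hlamR.le
      rwa [mul_one_div_cancel hlamR.ne'] at this
    have hn0 : (0 : ℝ) ≤ n := Nat.cast_nonneg n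
    nlinarith
  have hlim := Literature.NumberTheory.DiophantineApproximation.RhinViola.tendsto_sum_log_prime_fract_div_cutoff
    hu huvR hv1R (fun n => (M - 2 * dmin) * n) hN (C := (M : ℝ)) (Nat.cast_nonneg M)
  refine hlim.congr' ?_
  filter_upwards [eventually_ge_atTop (J ^ 2)] with n hn
  rw [cell_filter_eq J M dmin hM C hn]

/-! ### A table: sum over the cells -/

/-- **The rate of a finite cell table.** `(1/n) Σ_p cellExp T n p · log p ⟶ cellRate T`.
[cite: Zudilin2004, §8 p. 270] -/
theorem tendsto_cellSum_div (J M dmin : ℕ) (h2 : 2 * dmin < M) (T : List SavingCell)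
    (hT : ∀ C ∈ T, C.WF (M - 2 * dmin) = true) :
    Tendsto (fun n : ℕ => (∑ p ∈ laiPrimes J M dmin n, (cellExp T n p : ℝ) * Real.log p) / n)
      atTop (𝓝 (cellRate T)) := by
  induction T with
  | nil => simp [cellExp, cellRate]
  | cons C T ih =>
    have hC : C.WF (M - 2 * dmin) = true := hT C (by simp)
    have hT' : ∀ C' ∈ T, C'.WF (M - 2 * dmin) = true := fun C' h => hT C' (by simp [h])
    have e : ∀ n : ℕ, (∑ p ∈ laiPrimes J M dmin n, (cellExp (C :: T) n p : ℝ) * Real.log p) / n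
        = (C.c : ℝ) * ((∑ p ∈ (laiPrimes J M dmin n).filter (fun p => C.mem n p), Real.log p) / n)
          + (∑ p ∈ laiPrimes J M dmin n, (cellExp T n p : ℝ) * Real.log p) / n := by
      intro n
      have hsplit : ∀ p, (cellExp (C :: T) n p : ℝ)
          = (((if C.mem n p then C.c else 0 : ℕ) : ℝ)) + (cellExp T n p : ℝ) := by
        intro p; simp [cellExp]
      simp_rw [hsplit, add_mul, sum_add_distrib, sum_cell_eq, add_div, mul_div_assoc]
    simp_rw [e]
    have hrate : cellRate (C :: T) = (C.c : ℝ) * C.density + cellRate T := by simp [cellRate]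
    rw [hrate]
    exact ((tendsto_sum_log_cell_div J M dmin h2 C hC).const_mul _).add (ih hT')

/-- **The saving rate of a finite cell table EXISTS:** `(1/n) log laiPhiGen J M dmin (cellExp T) n ⟶ cellRate T`.
[cite: Lai2024BallRivoal, Lemma 5.3] -/
theorem tendsto_log_laiPhiGen_cellExp_div (J M dmin : ℕ) (h2 : 2 * dmin < M) (T : List SavingCell)
    (hT : ∀ C ∈ T, C.WF (M - 2 * dmin) = true) :
    Tendsto (fun n : ℕ => Real.log ((laiPhiGen J M dmin (cellExp T) n : ℕ) : ℝ) / n)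
      atTop (𝓝 (cellRate T)) := by
  simp_rw [log_laiPhiGen]
  exact tendsto_cellSum_div J M dmin h2 T hT

/-! ### Computable bounds for the rate -/

namespace SavingCell

/-- `Σ_{k<K} (1/(k+u) − 1/(k+v)) ≤ ψ(v) − ψ(u)` for `0 < u ≤ v ≤ u + 1`. [folklore] -/
theorem densityTrunc_le_density (C : SavingCell) (hu : 0 < C.u) (huv : C.u ≤ C.v) (hv : C.v ≤ C.u + 1)
    (K : ℕ) : ((C.densityTrunc K : ℚ) : ℝ) ≤ C.density := by
  have huR : (0 : ℝ) < (C.u : ℝ) := by exact_mod_cast hu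
  have huvR : (C.u : ℝ) ≤ (C.v : ℝ) := by exact_mod_cast huv
  have hvR : (C.v : ℝ) ≤ (C.u : ℝ) + 1 := by exact_mod_cast hv
  unfold densityTrunc density
  push_cast
  refine Summable.sum_le_tsum (range K) (fun k _ => ?_)
    (Literature.NumberTheory.DiophantineApproximation.RhinViola.summable_densityTerm huR huvR hvR)
  exact Literature.NumberTheory.DiophantineApproximation.RhinViola.densityTerm_nonneg huR huvR k

/-- `Σ_{k<m} 1/(k+1+u)² ≤ 2 − 2/(m+1)` for `u ≥ 0` (telescoping `1/(k+1)² ≤ 2/(k+1) − 2/(k+2)`). [folklore] -/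
theorem sum_inv_sq_succ_le {u : ℝ} (hu : 0 ≤ u) (m : ℕ) :
    ∑ k ∈ range m, 1 / ((k : ℝ) + 1 + u) ^ 2 ≤ 2 - 2 / ((m : ℝ) + 1) := by
  induction m with
  | zero => simp
  | succ m ih =>
    rw [sum_range_succ]
    have hm1 : (0 : ℝ) < (m : ℝ) + 1 := by positivity
    have h1 : 1 / ((m : ℝ) + 1 + u) ^ 2 ≤ 1 / ((m : ℝ) + 1) ^ 2 := by
      apply one_div_le_one_div_of_le (by positivity)
      exact pow_le_pow_left₀ hm1.le (by linarith) 2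
    have h2 : 1 / ((m : ℝ) + 1) ^ 2 ≤ 2 / ((m : ℝ) + 1) - 2 / (((m + 1 : ℕ) : ℝ) + 1) := by
      have e : 2 / ((m : ℝ) + 1) - 2 / (((m + 1 : ℕ) : ℝ) + 1) = 2 / (((m : ℝ) + 1) * ((m : ℝ) + 2)) := by
        push_cast; field_simp; ring
      rw [e, div_le_div_iff₀ (by positivity) (by positivity)]
      nlinarith
    linarith

/-- `Σ_{k<m} 1/(k+u)² ≤ 1/u² + 2` for `u > 0`. [folklore] -/
theorem sum_inv_sq_shift_le {u : ℝ} (hu : 0 < u) (m : ℕ) :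
    ∑ k ∈ range m, 1 / ((k : ℝ) + u) ^ 2 ≤ 1 / u ^ 2 + 2 := by
  cases m with
  | zero => simp; positivity
  | succ m =>
    rw [sum_range_succ']
    simp only [Nat.cast_zero, zero_add, Nat.cast_succ]
    have h := sum_inv_sq_succ_le hu.le m
    have h2 : (0 : ℝ) ≤ 2 / ((m : ℝ) + 1) := by positivity
    linarith

/-- `ψ(v) − ψ(u) ≤ (v − u)(1/u² + 2)` for `0 < u ≤ v`. [folklore] -/
theorem density_le_densityUB (C : SavingCell) (hu : 0 < C.u) (huv : C.u ≤ C.v) :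
    C.density ≤ ((C.densityUB : ℚ) : ℝ) := by
  have huR : (0 : ℝ) < (C.u : ℝ) := by exact_mod_cast hu
  have huvR : (C.u : ℝ) ≤ (C.v : ℝ) := by exact_mod_cast huv
  unfold density densityUB
  push_cast
  refine Real.tsum_le_of_sum_range_le
    (fun k => Literature.NumberTheory.DiophantineApproximation.RhinViola.densityTerm_nonneg huR huvR k)
    (fun m => ?_)
  have hterm : ∀ k : ℕ, 1 / ((k : ℝ) + C.u) - 1 / ((k : ℝ) + C.v)
      ≤ ((C.v : ℝ) - C.u) * (1 / ((k : ℝ) + C.u) ^ 2) := by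
    intro k
    have hku : (0 : ℝ) < k + C.u := by positivity
    have hkv : (k : ℝ) + C.u ≤ k + C.v := by linarith
    have h0 : (0 : ℝ) ≤ (C.v : ℝ) - C.u := by linarith
    rw [div_sub_div _ _ hku.ne' (by linarith : ((k : ℝ) + C.v) ≠ 0)]
    have e1 : (1 * ((k : ℝ) + C.v) - ((k : ℝ) + C.u) * 1) = (C.v : ℝ) - C.u := by ring
    rw [e1]
    calc ((C.v : ℝ) - C.u) / (((k : ℝ) + C.u) * ((k : ℝ) + C.v))
        ≤ ((C.v : ℝ) - C.u) / (((k : ℝ) + C.u) * ((k : ℝ) + C.u)) :=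
          div_le_div_of_nonneg_left h0 (by positivity) (mul_le_mul_of_nonneg_left hkv hku.le)
      _ = ((C.v : ℝ) - C.u) * (1 / ((k : ℝ) + C.u) ^ 2) := by rw [sq]; ring
  calc ∑ k ∈ range m, (1 / ((k : ℝ) + C.u) - 1 / ((k : ℝ) + C.v))
      ≤ ∑ k ∈ range m, ((C.v : ℝ) - C.u) * (1 / ((k : ℝ) + C.u) ^ 2) := sum_le_sum fun k _ => hterm k
    _ = ((C.v : ℝ) - C.u) * ∑ k ∈ range m, 1 / ((k : ℝ) + C.u) ^ 2 := by rw [mul_sum]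
    _ ≤ ((C.v : ℝ) - C.u) * (1 / (C.u : ℝ) ^ 2 + 2) :=
        mul_le_mul_of_nonneg_left (sum_inv_sq_shift_le huR m) (by linarith)

end SavingCell

/-- `cellRateTrunc T K ≤ cellRate T` for well-formed cells. [folklore] -/
theorem cellRateTrunc_le (T : List SavingCell) {lam : ℕ} (hlam : 0 < lam)
    (hT : ∀ C ∈ T, C.WF lam = true) (K : ℕ) : ((cellRateTrunc T K : ℚ) : ℝ) ≤ cellRate T := by
  induction T with
  | nil => simp [cellRateTrunc, cellRate]
  | cons C T ih =>
    obtain ⟨hu0, huv, hv1⟩ := (SavingCell.wf_iff _ _).1 (hT C (by simp))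
    have hu : 0 < C.u := lt_of_lt_of_le (by positivity) hu0
    have h1 := C.densityTrunc_le_density hu huv.le (by linarith) K
    have h2 := ih fun C' h => hT C' (by simp [h])
    simp only [cellRateTrunc, cellRate, List.map_cons, List.sum_cons, Rat.cast_add, Rat.cast_mul,
      Rat.cast_natCast] at h2 ⊢
    gcongr

/-- `cellRate T ≤ cellRateUB T` for well-formed cells. [folklore] -/
theorem cellRate_le_UB (T : List SavingCell) {lam : ℕ} (hlam : 0 < lam)
    (hT : ∀ C ∈ T, C.WF lam = true) : cellRate T ≤ ((cellRateUB T : ℚ) : ℝ) := by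
  induction T with
  | nil => simp [cellRateUB, cellRate]
  | cons C T ih =>
    obtain ⟨hu0, huv, hv1⟩ := (SavingCell.wf_iff _ _).1 (hT C (by simp))
    have hu : 0 < C.u := lt_of_lt_of_le (by positivity) hu0
    have h1 := C.density_le_densityUB hu huv.le
    have h2 := ih fun C' h => hT C' (by simp [h])
    simp only [cellRateUB, cellRate, List.map_cons, List.sum_cons, Rat.cast_add, Rat.cast_mul,
      Rat.cast_natCast] at h2 ⊢
    gcongr

/-! ### Admissibility of a disjoint cell table, cell by cell -/

/-- A cell is ADMISSIBLE for `(J, r, M, δ, dmin)` when its exponent is a lower bound of the brick exponent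
`laiPhiDiv J r M n δ k p` for every prime of its class in the range of the saving factor.
[cite: Lai2024BallRivoal, §4 Lemma 4.3] -/
def SavingCell.Adm (J r M : ℕ) (δ : Fin J → ℕ) (dmin : ℕ) (C : SavingCell) : Prop :=
  ∀ n p k : ℕ, p.Prime → J ≤ p → p ≤ (M - 2 * dmin) * n → M * n < p ^ 2 →
    dmin * n ≤ k → k ≤ (M - dmin) * n → C.mem n p = true → ((C.c : ℕ) : ℤ) ≤ laiPhiDiv J r M n δ k p

/-- Pairwise disjointness of the cells (as subsets of `ℚ`). [folklore] -/
def CellsDisjoint (T : List SavingCell) : Prop :=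
  T.Pairwise fun C C' => ∀ t : ℚ, ¬ ((C.u ≤ t ∧ t < C.v) ∧ (C'.u ≤ t ∧ t < C'.v))

/-- For disjoint cells, `cellExp T n p` is the exponent of the cell containing `{n/p}`, or `0`: it is
bounded by any common bound of the exponents of the cells containing `{n/p}`. [folklore] -/
theorem cellExp_le_of_disjoint (T : List SavingCell) (hd : CellsDisjoint T) (n p : ℕ) (b : ℕ)
    (hb : ∀ C ∈ T, C.mem n p = true → C.c ≤ b) : cellExp T n p ≤ b := by
  induction T generalizing b with
  | nil => simp [cellExp]
  | cons C T ih =>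
    have hd' : CellsDisjoint T := (List.pairwise_cons.1 hd).2
    have hhead := (List.pairwise_cons.1 hd).1
    have e : cellExp (C :: T) n p = (if C.mem n p then C.c else 0) + cellExp T n p := by simp [cellExp]
    rw [e]
    by_cases hm : C.mem n p = true
    · rw [if_pos hm]
      have hrest : cellExp T n p ≤ 0 := by
        refine ih hd' (b := 0) (fun C' hC' hm' => ?_)
        exact absurd ⟨(C.mem_iff n p).1 hm, (C'.mem_iff n p).1 hm'⟩ (hhead C' hC' _)
      have := hb C (by simp) hm
      omega
    · rw [if_neg hm, zero_add]
      exact ih hd' (b := b) fun C' hC' hm' => hb C' (by simp [hC']) hm'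

/-- **Admissibility cell by cell.** A table of pairwise disjoint, individually admissible cells is an
admissible exponent table (`LaiExpAdmissible`, the hypothesis of `laiCoef_isInt_phi` / `laiCoef_dvd3_phi`).
[cite: Lai2024BallRivoal, §4 Lemma 4.3] -/
theorem laiExpAdmissible_cellExp (J r M : ℕ) (δ : Fin J → ℕ) (dmin : ℕ) (T : List SavingCell)
    (hd : CellsDisjoint T) (hadm : ∀ C ∈ T, C.Adm J r M δ dmin) :
    LaiExpAdmissible J r M δ dmin (cellExp T) := by
  intro n p k hp hJ hpn hsq hk1 hk2
  have h0 := laiPhiDiv_nonneg J r M n δ k hp.pos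
  have hle : cellExp T n p ≤ (laiPhiDiv J r M n δ k p).toNat := by
    refine cellExp_le_of_disjoint T hd n p _ fun C hC hm => ?_
    have := hadm C hC n p k hp hJ hpn hsq hk1 hk2 hm
    omega
  calc ((cellExp T n p : ℕ) : ℤ) ≤ ((laiPhiDiv J r M n δ k p).toNat : ℤ) := by exact_mod_cast hle
    _ = laiPhiDiv J r M n δ k p := Int.toNat_of_nonneg h0

end Summit.KontsevichZagierPeriods.Zeta5Search
end
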